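import Literature.AlgebraicGeometry.RealAlgebraic.DividingCurves
import Literature.NumberTheory.Transcendental.AnalytificationImplicit
import Literature.Topology.FourManifolds.PlaneLevelCircles
import HarnessLib

/-!
# Ovals of a compact nonsingular real plane curve: smooth Jordan curves, their insides, and
# the direction of the gradient

Topic `Literature/AlgebraicGeometry/RealAlgebraic`; sequel to `DividingCurves.lean` (vocabulary
`realGrad`, `ovalInterior`, `gradOutwardSign`). For a polynomial `p` in two variables with
coefficients mapped into `ℝ` whose real zero locus `Z = {u ∈ ℝ² | p(u) = 0}` is COMPACT and
NONSINGULAR (`∇p ≠ 0` along `Z`), every connected component `O` of `Z` (an *oval*) is a smoothly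
embedded circle bounding a smoothly embedded disc, and the gradient `∇p` points out of that disc
along all of `O` or into it along all of `O`. **Everything here is proved; no definition and no
named fact is introduced.**

* `exists_schoenflies_oval` — for `v ∈ Z` there is a smooth embedding `e : ℝ² → ℝ²` of the
  model plane with `e(𝕊¹) = O`, the component of `v`, and `ℝ² ∖ e(𝔻²)` connected and unbounded
  (regular value theorem + classification of compact `1`-manifolds, the tree's
  `Literature.Topology.FourManifolds.PlaneLevelCircles.exists_levelCircles`; smooth Schoenflies
  theorem in the plane, the tree's
  `Literature.Topology.FourManifolds.SchoenfliesPlane.exists_isSmoothEmbedding`);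
* `ovalInterior_eq_image_ball` — the route convention `ovalInterior O` (union of the bounded
  complementary components) is the open disc `e(𝔹²)`;
* `exists_box` — at `v ∈ Z` there are arbitrarily small open boxes `B ∋ v` (sides along
  `J ∇p(v)` and `∇p(v)`) in which `{p > 0}` and `{p < 0}` are connected: `r ↦ p(v + s J∇p(v) +
  r ∇p(v))` is strictly increasing (elementary real analysis, no implicit function needed);
* `gradOutwardSign_eq_one_or_forall_eq_neg_one` — **the two sides of an oval**: along each oval
  `O`, `gradOutwardSign p O v` is constantly `+1` (the gradient points out of the inside of `O`)
  or constantly `-1`: in a box the two signs of `p` lie on the two sides of `O` (both the inside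
  and the outside have frontier `O`), and this is locally constant along the connected `O`.

These are the real-locus inputs of the well-definedness of Rokhlin's complex orientations
(`complexOrientationSign_isUnit_of_isDividing`, file `ComplexOrientationFormula.lean`; Rokhlin
1974 §2, Degtyarev–Kharlamov 2000 §1: ovals of a nonsingular compact real curve are smooth
Jordan curves with the curve on one side locally).

## References

* [Rokhlin1974] V. A. Rokhlin, Complex orientations of real algebraic curves, Funct. Anal. Appl.
  8 (1974) 331–334, §2.
* [DegtyarevKharlamov2000] A. Degtyarev, V. Kharlamov, Topological properties of real algebraic
  varieties: du côté de chez Rokhlin, Russian Math. Surveys 55 (2000), §1.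
* [MilnorTDV1965] J. Milnor, Topology from the Differentiable Viewpoint (1965), Appendix.
* [Schultens2014] J. Schultens, Introduction to 3-Manifolds (2014), proof of Thm. 3.2.5.
-/

noncomputable section

open MvPolynomial Set Filter Metric
open scoped _root_.Topology _root_.Manifold _root_.ContDiff

namespace Literature.AlgebraicGeometry.RealAlgebraic

variable {R : Type*} [CommSemiring R] [Algebra R ℝ] [Algebra R ℂ] [IsScalarTower R ℝ ℂ]

/-! ### The real polynomial function and its derivative -/

section PolyFun

variable (p : MvPolynomial (Fin 2) R)

omit [Algebra R ℂ] [IsScalarTower R ℝ ℂ] in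
/-- Evaluating at a real point is evaluating the real polynomial `map (algebraMap R ℝ) p`.
[folklore] -/
theorem aeval_eq_eval_map (u : Fin 2 → ℝ) : aeval u p = eval u (map (algebraMap R ℝ) p) := by
  rw [eval_map, aeval_def]

omit [Algebra R ℂ] [IsScalarTower R ℝ ℂ] in
/-- The real polynomial function `u ↦ p(u)` is smooth. [folklore] -/
theorem contDiff_aeval {n : WithTop ℕ∞} : ContDiff ℝ n (fun u : Fin 2 → ℝ => aeval u p) := by
  rw [show (fun u : Fin 2 → ℝ => aeval u p) = fun u => eval u (map (algebraMap R ℝ) p) from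
    funext fun u => aeval_eq_eval_map p u]
  exact contDiff_iff_contDiffAt.2 fun u =>
    Literature.NumberTheory.Transcendental.contDiffAt_eval _ u

omit [Algebra R ℂ] [IsScalarTower R ℝ ℂ] in
/-- The real polynomial function is continuous. [folklore] -/
theorem continuous_aeval : Continuous (fun u : Fin 2 → ℝ => aeval u p) :=
  (contDiff_aeval p (n := 0)).continuous

/-- The gradient is continuous. [folklore] -/
theorem continuous_realGrad : Continuous (fun u : Fin 2 → ℝ => realGrad p u) := by
  refine continuous_pi fun i => ?_
  simp_rw [realGrad_apply]
  exact continuous_aeval (pderiv i p)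

/-- **The derivative of the real polynomial function is the gradient**:
`Dp(u) v = Σᵢ ∂ᵢp(u) vᵢ`. [folklore] -/
theorem hasFDerivAt_aeval (u : Fin 2 → ℝ) :
    HasFDerivAt (fun u : Fin 2 → ℝ => aeval u p)
      (∑ i, realGrad p u i • (ContinuousLinearMap.proj i : (Fin 2 → ℝ) →L[ℝ] ℝ)) u := by
  have h := Literature.NumberTheory.Transcendental.hasFDerivAt_eval (map (algebraMap R ℝ) p) u
  have hsum : (∑ i, eval u (pderiv i (map (algebraMap R ℝ) p)) •
      (ContinuousLinearMap.proj i : (Fin 2 → ℝ) →L[ℝ] ℝ)) =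
      ∑ i, realGrad p u i • (ContinuousLinearMap.proj i : (Fin 2 → ℝ) →L[ℝ] ℝ) := by
    refine Finset.sum_congr rfl fun i _ => ?_
    rw [realGrad_apply, pderiv_map, ← aeval_eq_eval_map]
  rw [hsum] at h
  rw [show (fun u : Fin 2 → ℝ => aeval u p) = fun u => eval u (map (algebraMap R ℝ) p) from
    funext fun u => aeval_eq_eval_map p u]
  exact h

/-- The derivative of `p` along the line `s ↦ u + s a` at `s = 0` is `⟪∇p(u), a⟫`. [folklore] -/
theorem hasDerivAt_aeval_lineMap (u a : Fin 2 → ℝ) (s₀ : ℝ) :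
    HasDerivAt (fun s : ℝ => aeval (u + s • a) p)
      (∑ i, realGrad p (u + s₀ • a) i * a i) s₀ := by
  have hline : HasDerivAt (fun s : ℝ => u + s • a) a s₀ := by
    simpa using ((hasDerivAt_id s₀).smul_const a).const_add u
  have h := (hasFDerivAt_aeval p (u + s₀ • a)).comp_hasDerivAt s₀ hline
  have hval : (∑ i, realGrad p (u + s₀ • a) i • (ContinuousLinearMap.proj i : (Fin 2 → ℝ) →L[ℝ] ℝ))
      a = ∑ i, realGrad p (u + s₀ • a) i * a i := by
    simp
  rw [hval] at h
  exact h

/-- At a real zero with `∇p(u) ≠ 0`, `p` is positive on `u + s ∇p(u)` and negative on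
`u - s ∇p(u)` for all small `s > 0`. [folklore] -/
theorem eventually_pos_neg_along_realGrad {u : Fin 2 → ℝ} (hu : aeval u p = 0)
    (hgrad : realGrad p u ≠ 0) :
    ∀ᶠ s in 𝓝[>] (0 : ℝ), 0 < aeval (u + s • realGrad p u) p ∧ aeval (u - s • realGrad p u) p < 0 := by
  set a := realGrad p u with ha
  set c : ℝ := ∑ i, a i * a i with hc
  have hcpos : 0 < c := by
    have h0 : 0 ≤ a 0 * a 0 := mul_self_nonneg _
    have h1 : 0 ≤ a 1 * a 1 := mul_self_nonneg _
    have hne : a 0 * a 0 + a 1 * a 1 ≠ 0 := by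
      intro h
      apply hgrad
      have h0' : a 0 = 0 := by nlinarith [mul_self_nonneg (a 0), mul_self_nonneg (a 1)]
      have h1' : a 1 = 0 := by nlinarith [mul_self_nonneg (a 0), mul_self_nonneg (a 1)]
      funext i; fin_cases i <;> simp [h0', h1']
    rw [hc, Fin.sum_univ_two]
    exact lt_of_le_of_ne (add_nonneg h0 h1) (Ne.symm hne)
  have hd : HasDerivAt (fun s : ℝ => aeval (u + s • a) p) c 0 := by
    have := hasDerivAt_aeval_lineMap p u a 0
    simpa [hc] using this
  -- little-o form of the derivative
  have ho := hd.isLittleO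
  rw [Asymptotics.isLittleO_iff] at ho
  have h2 : (0 : ℝ) < c / 2 := by positivity
  have hev := ho h2
  simp only [zero_smul, add_zero, hu, sub_zero] at hev
  rw [Metric.eventually_nhds_iff] at hev
  obtain ⟨δ, hδ, hball⟩ := hev
  rw [eventually_nhdsWithin_iff, Metric.eventually_nhds_iff]
  refine ⟨δ, hδ, fun s hs hs0 => ?_⟩
  have hs0' : (0 : ℝ) < s := hs0
  have hsc : 0 < s * c := mul_pos hs0' hcpos
  have hpos := hball hs
  have hneg := hball (y := -s) (by simpa [dist_zero_right] using hs)
  rw [Real.norm_eq_abs, Real.norm_eq_abs, abs_le, abs_of_pos hs0'] at hpos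
  rw [Real.norm_eq_abs, norm_neg, Real.norm_eq_abs, abs_le, abs_of_pos hs0'] at hneg
  simp only [smul_eq_mul, neg_mul, sub_neg_eq_add] at hpos hneg
  refine ⟨?_, ?_⟩
  · linarith [hpos.1]
  · have : u - s • a = u + (-s) • a := by rw [neg_smul, sub_eq_add_neg]
    rw [this]
    linarith [hneg.2]

end PolyFun

/-! ### Ovals are smoothly embedded circles bounding smoothly embedded discs -/

section Ovals

variable (p : MvPolynomial (Fin 2) R)

omit [Algebra R ℂ] [IsScalarTower R ℝ ℂ] in
/-- The coordinate plane `ℝ²` has dimension two. [folklore] -/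
theorem finrank_plane : Module.finrank ℝ (Fin 2 → ℝ) = 2 := by
  simp

/-- At a point with `∇p ≠ 0` the Fréchet derivative of the polynomial function is non-zero
(so a nonsingular real locus is a regular level set). [folklore] -/
theorem fderiv_aeval_ne_zero {u : Fin 2 → ℝ} (hgrad : realGrad p u ≠ 0) :
    fderiv ℝ (fun u : Fin 2 → ℝ => aeval u p) u ≠ 0 := by
  rw [(hasFDerivAt_aeval p u).fderiv]
  intro h
  apply hgrad
  funext i
  have := congrArg (fun L : (Fin 2 → ℝ) →L[ℝ] ℝ => L (Pi.single i 1)) h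
  fin_cases i <;> simpa [Fin.sum_univ_two] using this

/-- **Ovals are smooth Jordan curves bounding smooth discs.** Let the real zero locus
`Z = {p = 0} ⊆ ℝ²` be compact with `∇p ≠ 0` along it, and `v ∈ Z`. Then there is a smooth
embedding `e : ℝ² → ℝ²` of the model plane whose boundary circle `e(𝕊¹)` is the connected
component `O` of `v` in `Z`, with `ℝ² ∖ e(𝔻²)` connected and unbounded; moreover `Z ∖ O` is
closed (the other components stay away from `O`). Assembled from the tree's level-curve theorem
(`PlaneLevelCircles.exists_levelCircles`: regular value theorem and Milnor's classification of
compact `1`-manifolds) and smooth planar Schoenflies theorem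
(`SchoenfliesPlane.exists_isSmoothEmbedding`). [cite: MilnorTDV1965, Appendix (Classifying 1-manifolds)] -/
theorem exists_schoenflies_oval (hZ : IsCompact {u : Fin 2 → ℝ | aeval u p = 0})
    (hreg : ∀ u : Fin 2 → ℝ, aeval u p = 0 → realGrad p u ≠ 0) {v : Fin 2 → ℝ}
    (hv : aeval v p = 0) :
    ∃ e : EuclideanSpace ℝ (Fin 2) → (Fin 2 → ℝ),
      Manifold.IsSmoothEmbedding (𝓡 2) 𝓘(ℝ, Fin 2 → ℝ) ∞ e ∧
      e '' sphere 0 1 = connectedComponentIn {u : Fin 2 → ℝ | aeval u p = 0} v ∧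
      IsConnected (e '' closedBall 0 1)ᶜ ∧ ¬ Bornology.IsBounded (e '' closedBall 0 1)ᶜ ∧
      IsClosed ({u : Fin 2 → ℝ | aeval u p = 0} \
        connectedComponentIn {u : Fin 2 → ℝ | aeval u p = 0} v) := by
  set Z : Set (Fin 2 → ℝ) := {u | aeval u p = 0} with hZdef
  have hZpre : (fun u : Fin 2 → ℝ => aeval u p) ⁻¹' {0} = Z := rfl
  obtain ⟨ι, _, γ, hγe, hγd, hγu, hγc⟩ :=
    Literature.Topology.FourManifolds.PlaneLevelCircles.exists_levelCircles (F := Fin 2 → ℝ)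
      finrank_plane (contDiff_aeval p) (a := 0)
      (fun x hx => fderiv_aeval_ne_zero p (hreg x hx)) (by rw [hZpre]; exact hZ)
  rw [hZpre] at hγu hγc
  have hvZ : v ∈ ⋃ i, range (γ i) := by rw [hγu]; exact hv
  obtain ⟨i, hi⟩ := mem_iUnion.1 hvZ
  have hO : connectedComponentIn Z v = range (γ i) := hγc i v hi
  obtain ⟨e, he, heS, hconn, hunb⟩ :=
    Literature.Topology.FourManifolds.SchoenfliesPlane.exists_isSmoothEmbedding finrank_plane
      (hγe i)
  refine ⟨e, he, by rw [heS, hO], hconn, hunb, ?_⟩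
  -- `Z ∖ O` is the finite union of the other (compact) circles
  have hdiff : Z \ connectedComponentIn Z v = ⋃ j ∈ {j | j ≠ i}, range (γ j) := by
    rw [hO]
    apply Subset.antisymm
    · rintro z ⟨hz, hzi⟩
      rw [← hγu] at hz
      obtain ⟨j, hj⟩ := mem_iUnion.1 hz
      have hji : j ≠ i := by
        rintro rfl
        exact hzi hj
      exact mem_biUnion hji hj
    · intro z hz
      obtain ⟨j, hji, hj⟩ := mem_iUnion₂.1 hz
      refine ⟨?_, fun hzi => Set.disjoint_left.1 (hγd hji) hj hzi⟩
      rw [← hγu]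
      exact mem_iUnion.2 ⟨j, hj⟩
  rw [hdiff]
  exact (Set.toFinite _).isClosed_biUnion fun j _ =>
    (isCompact_range (hγe j).contMDiff.continuous).isClosed

omit [Algebra R ℂ] [IsScalarTower R ℝ ℂ] in
/-- **The inside of an oval is the Schoenflies disc**: for a smooth embedding `e` of the model
plane into `ℝ²` with `ℝ² ∖ e(𝔻²)` connected and unbounded, the route's `ovalInterior (e(𝕊¹))`
(points off the curve whose complementary component is bounded) is the open disc `e(𝔹²)`.
[folklore] -/
theorem ovalInterior_eq_image_ball {e : EuclideanSpace ℝ (Fin 2) → (Fin 2 → ℝ)}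
    (he : Manifold.IsSmoothEmbedding (𝓡 2) 𝓘(ℝ, Fin 2 → ℝ) ∞ e)
    (hconn : IsConnected (e '' closedBall 0 1)ᶜ) (hunb : ¬ Bornology.IsBounded (e '' closedBall 0 1)ᶜ) :
    ovalInterior (e '' sphere 0 1) = e '' ball 0 1 := by
  have hinj := he.isEmbedding.injective
  ext u
  rw [mem_ovalInterior_iff]
  constructor
  · rintro ⟨huS, hbdd⟩
    have hu : u ∈ (e '' sphere 0 1)ᶜ := huS
    rw [Literature.Topology.FourManifolds.SchoenfliesPlane.compl_image_sphere_eq hinj] at hu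
    rcases hu with hu | hu
    · exact hu
    · exfalso
      apply hunb
      refine hbdd.subset (hconn.isPreconnected.subset_connectedComponentIn hu ?_)
      rw [Literature.Topology.FourManifolds.SchoenfliesPlane.compl_image_sphere_eq hinj]
      exact subset_union_right
  · intro hu
    have huS : u ∉ e '' sphere 0 1 := fun h =>
      Set.disjoint_left.1
        (Literature.Topology.FourManifolds.SchoenfliesPlane.disjoint_image_sphere_ball hinj) h hu
    refine ⟨huS, ?_⟩
    obtain ⟨-, -, hbdd⟩ :=
      Literature.Topology.FourManifolds.SchoenfliesPlane.isOpen_isConnected_isBounded_image_ball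
        finrank_plane he
    refine hbdd.subset ?_
    have hpre : IsPreconnected (connectedComponentIn (e '' sphere 0 1)ᶜ u) :=
      isPreconnected_connectedComponentIn
    have hdisj : Disjoint (connectedComponentIn (e '' sphere 0 1)ᶜ u) (e '' sphere 0 1) :=
      disjoint_compl_left.mono_left (connectedComponentIn_subset _ _)
    rcases Literature.Topology.FourManifolds.SchoenfliesPlane.subset_image_ball_or_subset_compl
      finrank_plane he hpre hdisj with h | h
    · exact h
    · exfalso
      have humem : u ∈ connectedComponentIn (e '' sphere 0 1)ᶜ u := mem_connectedComponentIn huS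
      exact Set.disjoint_left.1
        (Literature.Topology.FourManifolds.SchoenfliesPlane.disjoint_image_ball_compl e) hu (h humem)

end Ovals

/-! ### Boxes at a regular real zero: the two signs of `p` are connected -/

section Box

/-- A subset of an open box `(-ε, ε) × (-δ, δ)` whose vertical sections are intervals all
containing the height `r₀` is preconnected (each point is joined to the horizontal line at height
`r₀` by a vertical segment). [folklore] -/
theorem isPreconnected_box_inter {ε δ r₀ : ℝ} (hr₀ : r₀ ∈ Ioo (-δ) δ) {P : Set (ℝ × ℝ)}
    (hline : ∀ s ∈ Ioo (-ε) ε, (s, r₀) ∈ P)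
    (hord : ∀ s ∈ Ioo (-ε) ε, OrdConnected {r ∈ Ioo (-δ) δ | (s, r) ∈ P}) :
    IsPreconnected (Ioo (-ε) ε ×ˢ Ioo (-δ) δ ∩ P) := by
  set S := Ioo (-ε) ε ×ˢ Ioo (-δ) δ ∩ P with hS
  rcases S.eq_empty_or_nonempty with he | ⟨q₀, hq₀⟩
  · rw [he]; exact isPreconnected_empty
  have hL : Ioo (-ε) ε ×ˢ {r₀} ⊆ S := by
    rintro ⟨s, r⟩ ⟨hs, hr⟩
    rw [mem_singleton_iff] at hr
    subst hr
    exact ⟨⟨hs, hr₀⟩, hline s hs⟩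
  refine isPreconnected_of_forall (q₀.1, r₀) fun q hq => ?_
  have hq1 : q.1 ∈ Ioo (-ε) ε := hq.1.1
  have hV : {q.1} ×ˢ uIcc q.2 r₀ ⊆ S := by
    rintro ⟨s, r⟩ ⟨hs, hr⟩
    rw [mem_singleton_iff] at hs
    subst hs
    have hsec := (hord q.1 hq1).uIcc_subset (x := q.2) ⟨hq.1.2, hq.2⟩ (y := r₀) ⟨hr₀, hline _ hq1⟩ hr
    exact ⟨⟨hq1, hsec.1⟩, hsec.2⟩
  refine ⟨{q.1} ×ˢ uIcc q.2 r₀ ∪ Ioo (-ε) ε ×ˢ {r₀}, union_subset hV hL, ?_, ?_, ?_⟩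
  · exact Or.inr ⟨hq₀.1.1, rfl⟩
  · exact Or.inl ⟨rfl, left_mem_uIcc⟩
  · exact (isPreconnected_singleton.prod isPreconnected_uIcc).union (q.1, r₀) ⟨rfl, right_mem_uIcc⟩
      ⟨hq1, rfl⟩ (isPreconnected_Ioo.prod isPreconnected_singleton)

variable (p : MvPolynomial (Fin 2) R)

omit [Algebra R ℝ] [IsScalarTower R ℝ ℂ] in
/-- The box parametrisation `(s, r) ↦ v + s J∇p(v) + r ∇p(v)` at a point with `∇p(v) ≠ 0` is a
homeomorphism of `ℝ × ℝ` onto `ℝ²` (an affine map on an orthogonal basis; the inverse is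
`u ↦ (⟪u - v, J∇p(v)⟫, ⟪u - v, ∇p(v)⟫) / ‖∇p(v)‖²`). [folklore] -/
theorem exists_boxHomeomorph (v : Fin 2 → ℝ) (hgrad : realGrad p v ≠ 0) :
    ∃ φ : ℝ × ℝ ≃ₜ (Fin 2 → ℝ), ∀ q : ℝ × ℝ, φ q = v + q.1 • posTangent p v + q.2 • realGrad p v := by
  set a := realGrad p v with ha
  set c : ℝ := a 0 * a 0 + a 1 * a 1 with hcdef
  have hc : c ≠ 0 := by
    intro h
    apply hgrad
    have h0 : a 0 = 0 := by nlinarith [mul_self_nonneg (a 0), mul_self_nonneg (a 1)]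
    have h1 : a 1 = 0 := by nlinarith [mul_self_nonneg (a 0), mul_self_nonneg (a 1)]
    funext i; fin_cases i <;> simp [h0, h1]
  refine ⟨{ toFun := fun q => v + q.1 • posTangent p v + q.2 • realGrad p v
            invFun := fun u => (((u 0 - v 0) * (-a 1) + (u 1 - v 1) * a 0) / c,
              ((u 0 - v 0) * a 0 + (u 1 - v 1) * a 1) / c)
            left_inv := ?_
            right_inv := ?_
            continuous_toFun := by fun_prop
            continuous_invFun := by fun_prop }, fun q => rfl⟩
  · rintro ⟨s, r⟩
    simp only [posTangent, Pi.add_apply, Pi.smul_apply, Matrix.cons_val_zero, Matrix.cons_val_one,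
      smul_eq_mul, Prod.mk.injEq, ← ha]
    constructor
    · field_simp
      ring
    · field_simp
      ring
  · intro u
    funext i
    fin_cases i
    · simp only [posTangent, Fin.zero_eta, Pi.add_apply, Pi.smul_apply, Matrix.cons_val_zero,
        smul_eq_mul, ← ha]
      field_simp
      ring
    · simp only [posTangent, Fin.mk_one, Pi.add_apply, Pi.smul_apply, Matrix.cons_val_one,
        Matrix.cons_val_zero, smul_eq_mul, ← ha]
      field_simp
      ring

/-- **Boxes at a regular real zero.** At `v ∈ Z` with `∇p(v) ≠ 0` there are, inside any
neighbourhood `W` of `v`, open boxes `B ∋ v` in which both `{p > 0}` and `{p < 0}` are connected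
(and nonempty): in the coordinates `v + s J∇p(v) + r ∇p(v)` the function `r ↦ p` is strictly
increasing for `|s|, |r|` small, positive at height `δ/2` and negative at height `-δ/2`.
[folklore] -/
theorem exists_box {v : Fin 2 → ℝ} (hv : aeval v p = 0) (hgrad : realGrad p v ≠ 0)
    {W : Set (Fin 2 → ℝ)} (hW : W ∈ 𝓝 v) :
    ∃ B : Set (Fin 2 → ℝ), B ⊆ W ∧ IsOpen B ∧ v ∈ B ∧
      IsConnected (B ∩ {u | 0 < aeval u p}) ∧ IsConnected (B ∩ {u | aeval u p < 0}) := by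
  obtain ⟨φ, hφ⟩ := exists_boxHomeomorph p v hgrad
  set a := realGrad p v with ha
  set t := posTangent p v with ht
  have hφ0 : φ (0, 0) = v := by simp [hφ]
  set f : ℝ × ℝ → ℝ := fun q => aeval (φ q) p with hf
  -- the `r`-derivative of `f`
  set D : ℝ × ℝ → ℝ := fun q => ∑ i, realGrad p (φ q) i * a i with hD
  have hderiv : ∀ s r : ℝ, HasDerivAt (fun r => f (s, r)) (D (s, r)) r := by
    intro s r
    have := hasDerivAt_aeval_lineMap p (v + s • t) a r
    simpa [hf, hD, hφ] using this
  have hDcont : Continuous D :=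
    continuous_finsetSum _ fun i _ =>
      ((continuous_apply i).comp ((continuous_realGrad p).comp φ.continuous)).mul continuous_const
  have hD0 : 0 < D (0, 0) := by
    rw [hD]
    simp only [hφ0, Fin.sum_univ_two, ← ha]
    have hne : a 0 * a 0 + a 1 * a 1 ≠ 0 := by
      intro h
      apply hgrad
      have h0 : a 0 = 0 := by nlinarith [mul_self_nonneg (a 0), mul_self_nonneg (a 1)]
      have h1 : a 1 = 0 := by nlinarith [mul_self_nonneg (a 0), mul_self_nonneg (a 1)]
      funext i; fin_cases i <;> simp [h0, h1]
    exact lt_of_le_of_ne (add_nonneg (mul_self_nonneg _) (mul_self_nonneg _)) (Ne.symm hne)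
  -- a square neighbourhood of `0` where `D > 0` and `φ ∈ W`
  have hnhds : {q : ℝ × ℝ | 0 < D q} ∩ φ ⁻¹' W ∈ 𝓝 ((0 : ℝ), (0 : ℝ)) := by
    refine inter_mem ((isOpen_lt continuous_const hDcont).mem_nhds hD0) ?_
    exact φ.continuous.continuousAt.preimage_mem_nhds (by rw [hφ0]; exact hW)
  obtain ⟨ε₀, hε₀, hball⟩ := Metric.mem_nhds_iff.1 hnhds
  have hbox₀ : ∀ s r : ℝ, |s| < ε₀ → |r| < ε₀ → 0 < D (s, r) ∧ φ (s, r) ∈ W := by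
    intro s r hs hr
    have : ((s, r) : ℝ × ℝ) ∈ ball (0 : ℝ × ℝ) ε₀ := by
      simpa [mem_ball, Prod.dist_eq, Real.dist_eq] using max_lt hs hr
    exact hball this
  -- strict monotonicity of `r ↦ f (s, r)` on `(-ε₀, ε₀)` for `|s| < ε₀`
  have hmono : ∀ s : ℝ, |s| < ε₀ → StrictMonoOn (fun r => f (s, r)) (Ioo (-ε₀) ε₀) := by
    intro s hs
    refine strictMonoOn_of_deriv_pos (convex_Ioo _ _)
      (fun r _ => (hderiv s r).continuousAt.continuousWithinAt) fun r hr => ?_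
    rw [interior_Ioo] at hr
    rw [(hderiv s r).deriv]
    exact (hbox₀ s r hs (abs_lt.2 hr)).1
  -- heights `± δ/2`
  set δ : ℝ := ε₀ / 2 with hδ
  have hδpos : 0 < δ := by positivity
  have hδmem : ∀ r : ℝ, r ∈ Ioo (-δ) δ → r ∈ Ioo (-ε₀) ε₀ := fun r hr =>
    ⟨by linarith [hr.1], by linarith [hr.2]⟩
  have hhalf : δ / 2 ∈ Ioo (-δ) δ := ⟨by linarith, by linarith⟩
  have hhalf' : -(δ / 2) ∈ Ioo (-δ) δ := ⟨by linarith, by linarith⟩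
  have hf0 : f (0, 0) = 0 := by simp [hf, hφ0, hv]
  have hup0 : 0 < f (0, δ / 2) := by
    have h := hmono 0 (by simpa using hε₀) (hδmem _ ⟨by linarith, by linarith⟩) (hδmem _ hhalf)
      (by linarith : (0 : ℝ) < δ / 2)
    dsimp only at h
    rwa [hf0] at h
  have hdown0 : f (0, -(δ / 2)) < 0 := by
    have h := hmono 0 (by simpa using hε₀) (hδmem _ hhalf') (hδmem _ ⟨by linarith, by linarith⟩)
      (by linarith : -(δ / 2) < (0 : ℝ))
    dsimp only at h
    rwa [hf0] at h
  -- continuity in `s` at the two heights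
  have hfcont : Continuous f := (continuous_aeval p).comp φ.continuous
  have hev : ∀ᶠ s in 𝓝 (0 : ℝ), 0 < f (s, δ / 2) ∧ f (s, -(δ / 2)) < 0 ∧ |s| < ε₀ := by
    refine ((hfcont.comp (Continuous.prodMk_left (δ / 2))).continuousAt.eventually
      (isOpen_Ioi.mem_nhds hup0)).and (((hfcont.comp (Continuous.prodMk_left
      (-(δ / 2)))).continuousAt.eventually (isOpen_Iio.mem_nhds hdown0)).and ?_)
    have : Ioo (-ε₀) ε₀ ∈ 𝓝 (0 : ℝ) := isOpen_Ioo.mem_nhds ⟨by linarith, hε₀⟩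
    exact Filter.mem_of_superset this fun s hs => abs_lt.2 hs
  obtain ⟨ε, hε, hεball⟩ := Metric.eventually_nhds_iff.1 hev
  have hεs : ∀ s : ℝ, s ∈ Ioo (-ε) ε → 0 < f (s, δ / 2) ∧ f (s, -(δ / 2)) < 0 ∧ |s| < ε₀ :=
    fun s hs => hεball (by rw [Real.dist_eq, sub_zero]; exact abs_lt.2 hs)
  -- the box
  set Q : Set (ℝ × ℝ) := Ioo (-ε) ε ×ˢ Ioo (-δ) δ with hQ
  refine ⟨φ '' Q, ?_, φ.isOpenMap Q (isOpen_Ioo.prod isOpen_Ioo), ⟨(0, 0), ⟨⟨by linarith, hε⟩,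
    ⟨by linarith, hδpos⟩⟩, hφ0⟩, ?_, ?_⟩
  · rintro _ ⟨⟨s, r⟩, ⟨hs, hr⟩, rfl⟩
    exact (hbox₀ s r (hεs s hs).2.2 (abs_lt.2 (hδmem r hr))).2
  · rw [show φ '' Q ∩ {u | 0 < aeval u p} = φ '' (Q ∩ {q | 0 < f q}) from
      (image_inter_preimage φ Q {u | 0 < aeval u p}).symm]
    have hpre : IsPreconnected (Q ∩ {q : ℝ × ℝ | 0 < f q}) := by
      refine isPreconnected_box_inter hhalf (P := {q | 0 < f q}) (fun s hs => (hεs s hs).1)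
        fun s hs => ⟨fun r hr r' hr' x hx => ?_⟩
      have hx' : x ∈ Ioo (-δ) δ := ⟨lt_of_lt_of_le hr.1.1 hx.1, lt_of_le_of_lt hx.2 hr'.1.2⟩
      refine ⟨hx', show 0 < f (s, x) from lt_of_lt_of_le hr.2 ?_⟩
      exact (hmono s (hεs s hs).2.2).monotoneOn (hδmem r hr.1) (hδmem x hx') hx.1
    exact ⟨⟨φ (0, δ / 2), (0, δ / 2), ⟨⟨⟨by linarith, hε⟩, hhalf⟩, hup0⟩, rfl⟩,
      hpre.image _ φ.continuous.continuousOn⟩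
  · rw [show φ '' Q ∩ {u | aeval u p < 0} = φ '' (Q ∩ {q | f q < 0}) from
      (image_inter_preimage φ Q {u | aeval u p < 0}).symm]
    have hpre : IsPreconnected (Q ∩ {q : ℝ × ℝ | f q < 0}) := by
      refine isPreconnected_box_inter hhalf' (P := {q | f q < 0}) (fun s hs => (hεs s hs).2.1)
        fun s hs => ⟨fun r hr r' hr' x hx => ?_⟩
      have hx' : x ∈ Ioo (-δ) δ := ⟨lt_of_lt_of_le hr.1.1 hx.1, lt_of_le_of_lt hx.2 hr'.1.2⟩
      refine ⟨hx', show f (s, x) < 0 from lt_of_le_of_lt ?_ hr'.2⟩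
      exact (hmono s (hεs s hs).2.2).monotoneOn (hδmem x hx') (hδmem r' hr'.1) hx.2
    exact ⟨⟨φ (0, -(δ / 2)), (0, -(δ / 2)), ⟨⟨⟨by linarith, hε⟩, hhalf'⟩, hdown0⟩, rfl⟩,
      hpre.image _ φ.continuous.continuousOn⟩

end Box

/-! ### The two sides of an oval and the direction of the gradient -/

section Sides

/-- A function with values in `ℤ` which is locally constant along a preconnected set is constant
on it. [folklore] -/
theorem eq_of_eventually_eq_of_isPreconnected {X : Type*} [TopologicalSpace X] {s : Set X}
    (hs : IsPreconnected s) {f : X → ℤ} (h : ∀ x ∈ s, ∀ᶠ y in 𝓝 x, y ∈ s → f y = f x)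
    {x y : X} (hx : x ∈ s) (hy : y ∈ s) : f x = f y :=
  hs.constant (fun z hz => (continuousWithinAt_const (b := f z)).congr_of_eventuallyEq
    (eventually_nhdsWithin_iff.2 (h z hz)) rfl) hx hy

variable (p : MvPolynomial (Fin 2) R)

omit [Algebra R ℝ] [IsScalarTower R ℝ ℂ] in
/-- `gradOutwardSign p O v = -1` exactly when `∇p(v)` points into the interior of `O` (mirror of
`gradOutwardSign_eq_one_iff`). [folklore] -/
theorem gradOutwardSign_eq_neg_one_iff (O : Set (Fin 2 → ℝ)) (v : Fin 2 → ℝ) :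
    gradOutwardSign p O v = -1 ↔ ∀ᶠ s in 𝓝[>] (0 : ℝ),
      v + s • realGrad p v ∈ ovalInterior O ∧ v - s • realGrad p v ∉ ovalInterior O := by
  classical
  unfold gradOutwardSign
  by_cases h1 : ∀ᶠ s in 𝓝[>] (0 : ℝ),
      v + s • realGrad p v ∉ ovalInterior O ∧ v - s • realGrad p v ∈ ovalInterior O
  · by_cases h2 : ∀ᶠ s in 𝓝[>] (0 : ℝ),
        v + s • realGrad p v ∈ ovalInterior O ∧ v - s • realGrad p v ∉ ovalInterior O
    · obtain ⟨s, hs⟩ := (h1.and h2).exists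
      exact (hs.2.2 hs.1.2).elim
    · rw [if_pos h1, if_neg h2]
      exact iff_of_false (by norm_num) h2
  · by_cases h2 : ∀ᶠ s in 𝓝[>] (0 : ℝ),
        v + s • realGrad p v ∈ ovalInterior O ∧ v - s • realGrad p v ∉ ovalInterior O
    · rw [if_neg h1, if_pos h2]
      exact iff_of_true (by norm_num) h2
    · rw [if_neg h1, if_neg h2]
      exact iff_of_false (by norm_num) h2

omit [Algebra R ℂ] [IsScalarTower R ℝ ℂ] in
/-- **The two signs of `p` lie on the two sides of the oval.** Let `e` be a Schoenflies
embedding for the oval `S = e(𝕊¹)` (inside `U = e(𝔹²)`, outside `V = ℝ² ∖ e(𝔻²)`), on which `p`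
vanishes; let `B ∋ v` (`v ∈ S`) be an open set meeting the zero set of `p` only along `S`, in
which `{p > 0}` and `{p < 0}` are connected and nonempty. Then one of these two sets lies in `U`
and the other in `V` (both `U` and `V` have frontier `S`, so both meet `B` off `S`). [folklore] -/
theorem sides_of_box {e : EuclideanSpace ℝ (Fin 2) → (Fin 2 → ℝ)}
    (he : Manifold.IsSmoothEmbedding (𝓡 2) 𝓘(ℝ, Fin 2 → ℝ) ∞ e)
    (hS0 : ∀ u ∈ e '' sphere 0 1, aeval u p = 0) {v : Fin 2 → ℝ} (hvS : v ∈ e '' sphere 0 1)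
    {B : Set (Fin 2 → ℝ)} (hB : IsOpen B) (hvB : v ∈ B)
    (hBZ : ∀ u ∈ B, aeval u p = 0 → u ∈ e '' sphere 0 1)
    (hpos : IsConnected (B ∩ {u | 0 < aeval u p})) (hneg : IsConnected (B ∩ {u | aeval u p < 0})) :
    (B ∩ {u | 0 < aeval u p} ⊆ (e '' closedBall 0 1)ᶜ ∧ B ∩ {u | aeval u p < 0} ⊆ e '' ball 0 1) ∨
    (B ∩ {u | 0 < aeval u p} ⊆ e '' ball 0 1 ∧ B ∩ {u | aeval u p < 0} ⊆ (e '' closedBall 0 1)ᶜ) := by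
  have hinj := he.isEmbedding.injective
  set S := e '' sphere 0 1 with hSdef
  set U := e '' ball 0 1 with hUdef
  set V := (e '' closedBall 0 1)ᶜ with hVdef
  set P := B ∩ {u | 0 < aeval u p} with hPdef
  set N := B ∩ {u | aeval u p < 0} with hNdef
  have hUV : Disjoint U V := Literature.Topology.FourManifolds.SchoenfliesPlane.disjoint_image_ball_compl e
  have hUS : Disjoint S U :=
    Literature.Topology.FourManifolds.SchoenfliesPlane.disjoint_image_sphere_ball hinj
  have hVS : Disjoint S V :=
    disjoint_compl_right.mono_left (image_mono sphere_subset_closedBall)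
  obtain ⟨hfrU, hfrV⟩ :=
    Literature.Topology.FourManifolds.SchoenfliesPlane.frontier_image_ball finrank_plane he
  -- each sign set lies inside or outside
  have hPside : P ⊆ U ∨ P ⊆ V :=
    Literature.Topology.FourManifolds.SchoenfliesPlane.subset_image_ball_or_subset_compl
      finrank_plane he hpos.isPreconnected
      (Set.disjoint_left.2 fun u hu huS => (hS0 u huS ▸ hu.2 : (0 : ℝ) < 0).false)
  have hNside : N ⊆ U ∨ N ⊆ V :=
    Literature.Topology.FourManifolds.SchoenfliesPlane.subset_image_ball_or_subset_compl
      finrank_plane he hneg.isPreconnected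
      (Set.disjoint_left.2 fun u hu huS => (hS0 u huS ▸ hu.2 : (0 : ℝ) < 0).false)
  -- both `U` and `V` meet `B` in a point where `p ≠ 0`
  have hwit : ∀ T : Set (Fin 2 → ℝ), frontier T = S → Disjoint S T →
      (P ∩ T).Nonempty ∨ (N ∩ T).Nonempty := by
    intro T hfr hST
    have hvT : v ∈ closure T := frontier_subset_closure (hfr.symm ▸ hvS)
    obtain ⟨u, huB, huT⟩ := mem_closure_iff.1 hvT B hB hvB
    have hu0 : aeval u p ≠ 0 := fun h => Set.disjoint_left.1 hST (hBZ u huB h) huT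
    rcases lt_or_gt_of_ne hu0 with h | h
    · exact Or.inr ⟨u, ⟨huB, h⟩, huT⟩
    · exact Or.inl ⟨u, ⟨huB, h⟩, huT⟩
  have hPne := hpos.nonempty
  have hNne := hneg.nonempty
  rcases hwit U hfrU hUS with ⟨u, huP, huU⟩ | ⟨u, huN, huU⟩
  · -- `P` meets `U`, so `P ⊆ U`; then `N` must be the one meeting `V`
    have hPU : P ⊆ U := hPside.resolve_right fun h => Set.disjoint_left.1 hUV huU (h huP)
    right
    refine ⟨hPU, ?_⟩
    rcases hwit V hfrV hVS with ⟨u', hu'P, hu'V⟩ | ⟨u', hu'N, hu'V⟩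
    · exact (Set.disjoint_left.1 hUV (hPU hu'P) hu'V).elim
    · exact hNside.resolve_left fun h => Set.disjoint_left.1 hUV (h hu'N) hu'V
  · have hNU : N ⊆ U := hNside.resolve_right fun h => Set.disjoint_left.1 hUV huU (h huN)
    left
    refine ⟨?_, hNU⟩
    rcases hwit V hfrV hVS with ⟨u', hu'P, hu'V⟩ | ⟨u', hu'N, hu'V⟩
    · exact hPside.resolve_left fun h => Set.disjoint_left.1 hUV (h hu'P) hu'V
    · exact (Set.disjoint_left.1 hUV (hNU hu'N) hu'V).elim

/-- Along the gradient line at a regular real zero `v`, for small `s > 0` the point `v + s ∇p(v)`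
stays in the open set `B ∋ v` with `p > 0`, and `v - s ∇p(v)` stays in `B` with `p < 0`.
[folklore] -/
theorem eventually_mem_box_pos_neg {v : Fin 2 → ℝ} (hv : aeval v p = 0) (hgrad : realGrad p v ≠ 0)
    {B : Set (Fin 2 → ℝ)} (hB : IsOpen B) (hvB : v ∈ B) :
    ∀ᶠ s in 𝓝[>] (0 : ℝ), v + s • realGrad p v ∈ B ∩ {u | 0 < aeval u p} ∧
      v - s • realGrad p v ∈ B ∩ {u | aeval u p < 0} := by
  have h1 : Tendsto (fun s : ℝ => v + s • realGrad p v) (𝓝[>] 0) (𝓝 v) := by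
    have : Continuous fun s : ℝ => v + s • realGrad p v := by fun_prop
    simpa using (this.tendsto 0).mono_left nhdsWithin_le_nhds
  have h2 : Tendsto (fun s : ℝ => v - s • realGrad p v) (𝓝[>] 0) (𝓝 v) := by
    have : Continuous fun s : ℝ => v - s • realGrad p v := by fun_prop
    simpa using (this.tendsto 0).mono_left nhdsWithin_le_nhds
  filter_upwards [h1.eventually (hB.mem_nhds hvB), h2.eventually (hB.mem_nhds hvB),
    eventually_pos_neg_along_realGrad p hv hgrad] with s hs1 hs2 hs3
  exact ⟨⟨hs1, hs3.1⟩, ⟨hs2, hs3.2⟩⟩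

/-- If `{p > 0}` is outside and `{p < 0}` inside near `v`, the gradient points outward:
`gradOutwardSign = +1`. [folklore] -/
theorem gradOutwardSign_eq_one_of_sides {e : EuclideanSpace ℝ (Fin 2) → (Fin 2 → ℝ)}
    (he : Manifold.IsSmoothEmbedding (𝓡 2) 𝓘(ℝ, Fin 2 → ℝ) ∞ e)
    (hconn : IsConnected (e '' closedBall 0 1)ᶜ) (hunb : ¬ Bornology.IsBounded (e '' closedBall 0 1)ᶜ)
    {v : Fin 2 → ℝ} (hv : aeval v p = 0) (hgrad : realGrad p v ≠ 0)
    {B : Set (Fin 2 → ℝ)} (hB : IsOpen B) (hvB : v ∈ B)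
    (h : B ∩ {u | 0 < aeval u p} ⊆ (e '' closedBall 0 1)ᶜ ∧ B ∩ {u | aeval u p < 0} ⊆ e '' ball 0 1) :
    gradOutwardSign p (e '' sphere 0 1) v = 1 := by
  rw [gradOutwardSign_eq_one_iff, ovalInterior_eq_image_ball he hconn hunb]
  filter_upwards [eventually_mem_box_pos_neg p hv hgrad hB hvB] with s hs
  exact ⟨fun hU => Set.disjoint_left.1
    (Literature.Topology.FourManifolds.SchoenfliesPlane.disjoint_image_ball_compl e) hU (h.1 hs.1),
    h.2 hs.2⟩

/-- If `{p > 0}` is inside and `{p < 0}` outside near `v`, the gradient points inward: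
`gradOutwardSign = -1`. [folklore] -/
theorem gradOutwardSign_eq_neg_one_of_sides {e : EuclideanSpace ℝ (Fin 2) → (Fin 2 → ℝ)}
    (he : Manifold.IsSmoothEmbedding (𝓡 2) 𝓘(ℝ, Fin 2 → ℝ) ∞ e)
    (hconn : IsConnected (e '' closedBall 0 1)ᶜ) (hunb : ¬ Bornology.IsBounded (e '' closedBall 0 1)ᶜ)
    {v : Fin 2 → ℝ} (hv : aeval v p = 0) (hgrad : realGrad p v ≠ 0)
    {B : Set (Fin 2 → ℝ)} (hB : IsOpen B) (hvB : v ∈ B)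
    (h : B ∩ {u | 0 < aeval u p} ⊆ e '' ball 0 1 ∧ B ∩ {u | aeval u p < 0} ⊆ (e '' closedBall 0 1)ᶜ) :
    gradOutwardSign p (e '' sphere 0 1) v = -1 := by
  rw [gradOutwardSign_eq_neg_one_iff, ovalInterior_eq_image_ball he hconn hunb]
  filter_upwards [eventually_mem_box_pos_neg p hv hgrad hB hvB] with s hs
  exact ⟨h.1 hs.1, fun hU => Set.disjoint_left.1
    (Literature.Topology.FourManifolds.SchoenfliesPlane.disjoint_image_ball_compl e) hU (h.2 hs.2)⟩

/-- **The gradient points out of an oval along all of it, or into it along all of it.** For a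
compact nonsingular real zero locus `Z` and `v ∈ Z` with component (oval) `O`,
`gradOutwardSign p O` is constantly `+1` on `O` or constantly `-1` on `O`: at each point it is
`±1` by `sides_of_box`, the side pattern persists on the smaller boxes at nearby points of `O`,
and `O` is connected. [cite: Rokhlin1974, §2] -/
theorem gradOutwardSign_eq_one_or_eq_neg_one_on_oval
    (hZ : IsCompact {u : Fin 2 → ℝ | aeval u p = 0})
    (hreg : ∀ u : Fin 2 → ℝ, aeval u p = 0 → realGrad p u ≠ 0) {v : Fin 2 → ℝ}
    (hv : aeval v p = 0) :
    (∀ v' ∈ connectedComponentIn {u : Fin 2 → ℝ | aeval u p = 0} v,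
        gradOutwardSign p (connectedComponentIn {u : Fin 2 → ℝ | aeval u p = 0} v) v' = 1) ∨
    (∀ v' ∈ connectedComponentIn {u : Fin 2 → ℝ | aeval u p = 0} v,
        gradOutwardSign p (connectedComponentIn {u : Fin 2 → ℝ | aeval u p = 0} v) v' = -1) := by
  set Z : Set (Fin 2 → ℝ) := {u | aeval u p = 0} with hZdef
  obtain ⟨e, he, heS, hconn, hunb, hclosed⟩ := exists_schoenflies_oval p hZ hreg hv
  set O := connectedComponentIn Z v with hOdef
  have hOZ : O ⊆ Z := connectedComponentIn_subset _ _
  have hS0 : ∀ u ∈ e '' sphere 0 1, aeval u p = 0 := fun u hu => hOZ (heS ▸ hu)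
  -- local constancy with value `±1`
  have hloc : ∀ v' ∈ O, (gradOutwardSign p O v' = 1 ∨ gradOutwardSign p O v' = -1) ∧
      ∀ᶠ u in 𝓝 v', u ∈ O → gradOutwardSign p O u = gradOutwardSign p O v' := by
    intro v' hv'
    have hv'Z : aeval v' p = 0 := hOZ hv'
    have hW : (Z \ O)ᶜ ∈ 𝓝 v' := hclosed.isOpen_compl.mem_nhds fun h => h.2 hv'
    obtain ⟨B, hBW, hB, hv'B, hpos, hneg⟩ := exists_box p hv'Z (hreg v' hv'Z) hW
    have hBZ : ∀ u ∈ B, aeval u p = 0 → u ∈ e '' sphere 0 1 := by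
      intro u huB hu
      rw [heS]
      by_contra huO
      exact hBW huB ⟨hu, huO⟩
    have key : ∀ u ∈ O, u ∈ B → ∃ B' : Set (Fin 2 → ℝ), B' ⊆ B ∧ IsOpen B' ∧ u ∈ B' ∧
        IsConnected (B' ∩ {u | 0 < aeval u p}) ∧ IsConnected (B' ∩ {u | aeval u p < 0}) ∧
        ((B' ∩ {u | 0 < aeval u p} ⊆ (e '' closedBall 0 1)ᶜ ∧ B' ∩ {u | aeval u p < 0} ⊆ e '' ball 0 1) ∨
         (B' ∩ {u | 0 < aeval u p} ⊆ e '' ball 0 1 ∧ B' ∩ {u | aeval u p < 0} ⊆ (e '' closedBall 0 1)ᶜ)) := by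
      intro u huO huB
      have huZ : aeval u p = 0 := hOZ huO
      obtain ⟨B', hB'B, hB', huB', hpos', hneg'⟩ := exists_box p huZ (hreg u huZ) (hB.mem_nhds huB)
      exact ⟨B', hB'B, hB', huB', hpos', hneg', sides_of_box p he hS0 (heS.symm ▸ huO) hB' huB'
        (fun w hw hw0 => hBZ w (hB'B hw) hw0) hpos' hneg'⟩
    -- the side pattern at `v'` itself
    rcases sides_of_box p he hS0 (heS.symm ▸ hv') hB hv'B hBZ hpos hneg with hout | hin
    · have hval : ∀ u ∈ O, u ∈ B → gradOutwardSign p O u = 1 := by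
        intro u huO huB
        obtain ⟨B', hB'B, hB', huB', hpos', -, hsides⟩ := key u huO huB
        rcases hsides with hout' | hin'
        · rw [← heS]
          exact gradOutwardSign_eq_one_of_sides p he hconn hunb (hOZ huO) (hreg u (hOZ huO)) hB' huB'
            hout'
        · exfalso
          obtain ⟨w, hw⟩ := hpos'.nonempty
          exact hout.1 ⟨hB'B hw.1, hw.2⟩ (image_mono ball_subset_closedBall (hin'.1 hw))
      refine ⟨Or.inl (hval v' hv' hv'B), ?_⟩
      filter_upwards [hB.mem_nhds hv'B] with u huB huO
      rw [hval u huO huB, hval v' hv' hv'B]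
    · have hval : ∀ u ∈ O, u ∈ B → gradOutwardSign p O u = -1 := by
        intro u huO huB
        obtain ⟨B', hB'B, hB', huB', hpos', -, hsides⟩ := key u huO huB
        rcases hsides with hout' | hin'
        · exfalso
          obtain ⟨w, hw⟩ := hpos'.nonempty
          exact hout'.1 hw ((image_mono ball_subset_closedBall) (hin.1 ⟨hB'B hw.1, hw.2⟩))
        · rw [← heS]
          exact gradOutwardSign_eq_neg_one_of_sides p he hconn hunb (hOZ huO) (hreg u (hOZ huO))
            hB' huB' hin'
      refine ⟨Or.inr (hval v' hv' hv'B), ?_⟩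
      filter_upwards [hB.mem_nhds hv'B] with u huB huO
      rw [hval u huO huB, hval v' hv' hv'B]
  -- constancy along the connected `O`
  have hvO : v ∈ O := mem_connectedComponentIn hv
  have hconst : ∀ v' ∈ O, gradOutwardSign p O v' = gradOutwardSign p O v := fun v' hv' =>
    eq_of_eventually_eq_of_isPreconnected isPreconnected_connectedComponentIn
      (fun u hu => (hloc u hu).2) hv' hvO
  rcases (hloc v hvO).1 with h | h
  · exact Or.inl fun v' hv' => (hconst v' hv').trans h
  · exact Or.inr fun v' hv' => (hconst v' hv').trans h

end Sides

end Literature.AlgebraicGeometry.RealAlgebraic
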